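import Summits.Ventures.PercRepro.PendantLemma6

/-!
# The edge cross-term of the pendant Lemma 6 is non-negative

For marks `v i j k`, an edge `e`, and `p₀ = p[e ↦ 0]`, `p₁ = p[e ↦ 1]`, with
`x_s = P_s(F ∩ J)`, `R_s = P_s(F ∩ Jᶜ)`, `T_s = P_s(D ∩ J)`, `Y_s = P_s(D ∩ Jᶜ)`:

  `x₀ Y₁ + x₁ Y₀ ≤ R₀ T₁ + R₁ T₀`   (`pendant_B6`),

the «level-1» (Bernstein) cross-term of the pendant Lemma 6 along `e` (proofs/P1-lemma7.md §11).
Proof: the tower property given the cluster of `v` writes `x_s = E_s[Ψ(C_v)·H_s(C_v)]` with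
`H_s(W) = P_{zeroOn p_s (edges at W)}(J)`; the term with the `F`-copy at `e` closed is
pointwise non-negative (`H₀ ≤ Q₀ ≤ Q₁` and Harris at `e` open); the other term is split by
whether `e` touches the cluster: if it does, `H₁ = H₀ ≤ Q₀` and Harris at `e` closed suffices;
if not, the cluster law is the same under `p₀` and `p₁` (`prob_cluster_eq_update`), the term is
moved under `E₀`, and the abstract lemma `cross_abstract` (using `d₀ ≤ d₁`) closes it.
-/

namespace PercRepro

open Finset

namespace MultiGraph

variable {V E : Type*} (G : MultiGraph V E)

section Prob

variable [Fintype E] [DecidableEq E]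

/-- **The abstract cross-term lemma**: if `q₀ ≤ Q₀ ≤ Q₁`, `q₁ ≤ Q₁`, `T_s ≥ Q_s d_s`,
`Y_s ≤ (1 − Q_s) d_s` and `0 ≤ d₀ ≤ d₁`, then `(1−q₀)T₁ + (1−q₁)T₀ ≥ q₀Y₁ + q₁Y₀`. -/
theorem cross_abstract {q₀ q₁ Q₀ Q₁ T₀ T₁ Y₀ Y₁ d₀ d₁ : ℝ} (hq₀ : 0 ≤ q₀) (hq₁ : 0 ≤ q₁)
    (h₀ : q₀ ≤ Q₀) (h₀₁ : Q₀ ≤ Q₁) (h₁ : q₁ ≤ Q₁) (hQ₁ : Q₁ ≤ 1)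
    (hT₀ : Q₀ * d₀ ≤ T₀) (hT₁ : Q₁ * d₁ ≤ T₁) (hY₀ : Y₀ ≤ (1 - Q₀) * d₀)
    (hY₁ : Y₁ ≤ (1 - Q₁) * d₁) (hd₀ : 0 ≤ d₀) (hd : d₀ ≤ d₁) :
    q₀ * Y₁ + q₁ * Y₀ ≤ (1 - q₀) * T₁ + (1 - q₁) * T₀ := by
  have e1 : (1 - q₀) * T₁ ≥ (1 - q₀) * (Q₁ * d₁) :=
    mul_le_mul_of_nonneg_left hT₁ (by linarith)
  have e2 : (1 - q₁) * T₀ ≥ (1 - q₁) * (Q₀ * d₀) :=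
    mul_le_mul_of_nonneg_left hT₀ (by linarith)
  have e3 : q₀ * Y₁ ≤ q₀ * ((1 - Q₁) * d₁) := mul_le_mul_of_nonneg_left hY₁ hq₀
  have e4 : q₁ * Y₀ ≤ q₁ * ((1 - Q₀) * d₀) := mul_le_mul_of_nonneg_left hY₀ hq₁
  have key : d₁ * (Q₁ - q₀) ≥ d₀ * (Q₁ - q₀) :=
    mul_le_mul_of_nonneg_right hd (by linarith)
  nlinarith [e1, e2, e3, e4, key]

open Classical in
/-- The indicator of `F` as a function of the cluster of `v`. -/
noncomputable def pairFun (i j k : V) : Set V → ℝ := fun W => if i ∈ W ∧ j ∉ W ∧ k ∉ W then 1 else 0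

/-- The conditional probability of `J = {j ↔ k}` given the cluster of `v`: `J` computed with the
edges at the cluster switched off. -/
noncomputable def condJ (p : E → ℝ) (v j k : V) (ω : Config E) : ℝ :=
  prob (zeroOn p (G.touchingFinset (G.cluster ω v))) (G.connEvent j k)

open Classical in
omit [Fintype E] [DecidableEq E] in
/-- `pairFun` is nonnegative. -/
theorem pairFun_nonneg (i j k : V) (W : Set V) : 0 ≤ pairFun i j k W := by
  unfold pairFun
  split_ifs <;> norm_num

open Classical in
omit [Fintype E] [DecidableEq E] in
/-- `pairFun` vanishes when the mark `j` lies in the cluster `W`. -/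
theorem pairFun_of_mem (i j k : V) {W : Set V} (h : j ∈ W) : pairFun i j k W = 0 := by
  simp [pairFun, h]

open Classical in
omit [Fintype E] [DecidableEq E] in
/-- The indicator of the pair event as a function of the cluster of `v`. -/
theorem pairEvent_indicator_eq (v i j k : V) :
    (G.pairEvent v i j k).indicator (1 : Config E → ℝ) = fun ω => pairFun i j k (G.cluster ω v) := by
  funext ω
  by_cases hω : ω ∈ G.pairEvent v i j k
  · rw [Set.indicator_of_mem hω]
    have h := (G.mem_pairEvent_iff v i j k ω).1 hω
    show (1 : ℝ) = if i ∈ G.cluster ω v ∧ j ∉ G.cluster ω v ∧ k ∉ G.cluster ω v then 1 else 0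
    rw [if_pos h]
  · rw [Set.indicator_of_notMem hω]
    have h : ¬ (i ∈ G.cluster ω v ∧ j ∉ G.cluster ω v ∧ k ∉ G.cluster ω v) :=
      fun h => hω ((G.mem_pairEvent_iff v i j k ω).2 h)
    show (0 : ℝ) = if i ∈ G.cluster ω v ∧ j ∉ G.cluster ω v ∧ k ∉ G.cluster ω v then 1 else 0
    rw [if_neg h]

/-- `P(F) = E[Ψ(C_v)]`. -/
theorem prob_pairEvent_eq (p : E → ℝ) (v i j k : V) :
    prob p (G.pairEvent v i j k) = expect p (fun ω => pairFun i j k (G.cluster ω v)) := by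
  rw [prob_eq_expect_indicator, G.pairEvent_indicator_eq]

open Classical in
/-- **Tower property**: `P(F ∩ J) = E[Ψ(C_v) · condJ]`. -/
theorem prob_pairEvent_inter_connEvent_eq (p : E → ℝ) (v i j k : V) :
    prob p (G.pairEvent v i j k ∩ G.connEvent j k) =
      expect p (fun ω => pairFun i j k (G.cluster ω v) * G.condJ p v j k ω) := by
  have e1 : prob p (G.pairEvent v i j k ∩ G.connEvent j k) =
      expect p (fun ω => pairFun i j k (G.cluster ω v) * (G.connEvent j k).indicator 1 ω) := by
    rw [prob_eq_expect_indicator, Set.inter_indicator_one, G.pairEvent_indicator_eq]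
    rfl
  rw [e1, G.expect_clusterFun_mul_indicator v j p (G.clusterDet_connEvent j k) (pairFun i j k)
    (fun W hW => pairFun_of_mem i j k hW)]
  rfl

/-- `P(F ∩ Jᶜ) = E[Ψ(C_v) · (1 − condJ)]`. -/
theorem prob_pairEvent_inter_compl_eq (p : E → ℝ) (v i j k : V) :
    prob p (G.pairEvent v i j k ∩ (G.connEvent j k)ᶜ) =
      expect p (fun ω => pairFun i j k (G.cluster ω v) * (1 - G.condJ p v j k ω)) := by
  have h := prob_inter_add_prob_inter_compl p (G.pairEvent v i j k) (G.connEvent j k)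
  rw [G.prob_pairEvent_inter_connEvent_eq, G.prob_pairEvent_eq] at h
  have h2 : (fun ω => pairFun i j k (G.cluster ω v) * (1 - G.condJ p v j k ω)) =
      (fun ω => pairFun i j k (G.cluster ω v)) -
        fun ω => pairFun i j k (G.cluster ω v) * G.condJ p v j k ω := by
    funext ω
    simp only [Pi.sub_apply]
    ring
  rw [h2, expect_sub]
  linarith

/-- The conditional connection probability `condJ` is nonnegative. -/
theorem condJ_nonneg {p : E → ℝ} (hp : IsProb p) (v j k : V) (ω : Config E) :
    0 ≤ G.condJ p v j k ω :=
  prob_nonneg (isProb_zeroOn hp _) _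

/-- `condJ ≤ P(J)`. -/
theorem condJ_le {p : E → ℝ} (hp : IsProb p) (v j k : V) (ω : Config E) :
    G.condJ p v j k ω ≤ prob p (G.connEvent j k) :=
  prob_mono_of_isUpperSet (isProb_zeroOn hp _) hp (zeroOn_le hp _) (G.isUpperSet_connEvent j k)

/-- `condJ` is monotone in `p`. -/
theorem condJ_mono {p p' : E → ℝ} (hp : IsProb p) (hp' : IsProb p') (hle : p ≤ p') (v j k : V)
    (ω : Config E) : G.condJ p v j k ω ≤ G.condJ p' v j k ω := by
  refine prob_mono_of_isUpperSet (isProb_zeroOn hp _) (isProb_zeroOn hp' _) ?_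
    (G.isUpperSet_connEvent j k)
  intro e
  by_cases he : e ∈ G.touchingFinset (G.cluster ω v)
  · rw [zeroOn_apply_of_mem p he, zeroOn_apply_of_mem p' he]
  · rw [zeroOn_apply_of_notMem p he, zeroOn_apply_of_notMem p' he]
    exact hle e

/-- If `e` touches the cluster of `v`, `condJ` does not see the value of `p` at `e`. -/
theorem condJ_update_of_mem (p : E → ℝ) (v j k : V) (ω : Config E) {e : E}
    (he : e ∈ G.touchingFinset (G.cluster ω v)) (x y : ℝ) :
    G.condJ (Function.update p e x) v j k ω = G.condJ (Function.update p e y) v j k ω := by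
  unfold condJ
  congr 1
  funext e'
  by_cases he' : e' ∈ G.touchingFinset (G.cluster ω v)
  · rw [zeroOn_apply_of_mem _ he', zeroOn_apply_of_mem _ he']
  · rw [zeroOn_apply_of_notMem _ he', zeroOn_apply_of_notMem _ he']
    have hne : e' ≠ e := fun h => he' (h ▸ he)
    rw [Function.update_of_ne hne, Function.update_of_ne hne]

open Classical in
/-- **Locality of the cluster law**: `P(C_v = W)` is a function of `p` on the edges at `W`. -/
theorem prob_cluster_eq_eq_sum (p : E → ℝ) (v : V) (W : Set V) :
    prob p {ω | G.cluster ω v = W} =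
      ∑ ζ, weight (keepOn p (G.touchingFinset W)) ζ * (if G.cluster ζ v = W then 1 else 0) := by
  rw [prob_eq_sum_keepOn p (G.touchingFinset W)]
  refine Finset.sum_congr rfl fun ζ _ => ?_
  congr 1
  have h : {ω | ζ ⊔ ω ∈ {ω | G.cluster ω v = W}} = {ω | G.cluster (ζ ⊔ ω) v = W} := rfl
  rw [h]
  have hc : prob (zeroOn p (G.touchingFinset W)) {ω | G.cluster (ζ ⊔ ω) v = W} =
      prob (zeroOn p (G.touchingFinset W)) {ω | G.cluster ζ v = W} := by
    apply prob_congr_of_support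
    intro ω hω
    have hωK : ∀ e ∈ G.touchingFinset W, ω e = false := closedOn_of_weight_zeroOn_ne_zero hω
    simp only [Set.mem_setOf_eq]
    exact G.cluster_sup_eq_iff v (fun e => G.mem_touchingFinset) hωK
  rw [hc]
  by_cases hW : G.cluster ζ v = W
  · rw [if_pos hW]
    have : {ω : Config E | G.cluster ζ v = W} = Set.univ := Set.eq_univ_of_forall fun _ => hW
    rw [this, prob_univ]
  · rw [if_neg hW]
    have : {ω : Config E | G.cluster ζ v = W} = ∅ := Set.eq_empty_of_forall_notMem fun _ h => hW h
    rw [this]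
    simp [prob]

omit [Fintype E] in
/-- `keepOn` does not see an update off `K`. -/
theorem keepOn_update_of_notMem (p : E → ℝ) {K : Finset E} {e : E} (he : e ∉ K) (x y : ℝ) :
    keepOn (Function.update p e x) K = keepOn (Function.update p e y) K := by
  funext e'
  unfold keepOn
  by_cases he' : e' ∈ K
  · have hne : e' ≠ e := fun h => he (h ▸ he')
    simp [he', Function.update_of_ne hne]
  · simp [he']

/-- If `e` does not touch `W`, the law of `{C_v = W}` is the same under `p[e ↦ x]` and `p[e ↦ y]`. -/
theorem prob_cluster_eq_update (p : E → ℝ) (v : V) {W : Set V} {e : E}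
    (he : e ∉ G.touchingFinset W) (x y : ℝ) :
    prob (Function.update p e x) {ω | G.cluster ω v = W} =
      prob (Function.update p e y) {ω | G.cluster ω v = W} := by
  rw [G.prob_cluster_eq_eq_sum, G.prob_cluster_eq_eq_sum, keepOn_update_of_notMem p he x y]

open Classical in
/-- A function of the cluster of `v` has expectation `Σ_W g(W) P(C_v = W)`. -/
theorem expect_clusterFun_eq_sum (p : E → ℝ) (v : V) (g : Set V → ℝ) :
    expect p (fun ω => g (G.cluster ω v)) =
      ∑ W ∈ univ.image (fun ω => G.cluster ω v), g W * prob p {ω | G.cluster ω v = W} := by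
  rw [G.expect_eq_sum_cluster v p]
  refine Finset.sum_congr rfl fun W _ => ?_
  have h : (fun ω => if G.cluster ω v = W then g (G.cluster ω v) else 0) =
      fun ω => g W * ({ω | G.cluster ω v = W}.indicator 1 ω) := by
    funext ω
    by_cases hc : G.cluster ω v = W
    · rw [if_pos hc, hc]
      simp [Set.indicator, hc]
    · rw [if_neg hc]
      simp [Set.indicator, hc]
  rw [h, expect_const_mul, expect_indicator_one]

open Classical in
/-- **Change of measure**: a function of the cluster of `v` vanishing on clusters touched by `e`
has the same expectation under `p[e ↦ x]` and `p[e ↦ y]`. -/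
theorem expect_clusterFun_update_eq (p : E → ℝ) (v : V) (e : E) (x y : ℝ) (g : Set V → ℝ)
    (hg : ∀ W, e ∈ G.touchingFinset W → g W = 0) :
    expect (Function.update p e x) (fun ω => g (G.cluster ω v)) =
      expect (Function.update p e y) (fun ω => g (G.cluster ω v)) := by
  rw [G.expect_clusterFun_eq_sum, G.expect_clusterFun_eq_sum]
  refine Finset.sum_congr rfl fun W _ => ?_
  by_cases he : e ∈ G.touchingFinset W
  · rw [hg W he, zero_mul, zero_mul]
  · rw [G.prob_cluster_eq_update p v he x y]

/-- Linear bookkeeping: `E[f(1−h)]·c − E[fh]·d = E[f((1−h)c − hd)]`. -/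
theorem expect_comb (p : E → ℝ) (f h : Config E → ℝ) (c d : ℝ) :
    expect p (fun ω => f ω * (1 - h ω)) * c - expect p (fun ω => f ω * h ω) * d =
      expect p (fun ω => f ω * ((1 - h ω) * c - h ω * d)) := by
  have e1 : (fun ω => f ω * ((1 - h ω) * c - h ω * d)) =
      (fun ω => c * (f ω * (1 - h ω))) - fun ω => d * (f ω * h ω) := by
    funext ω
    simp only [Pi.sub_apply]
    ring
  rw [e1, expect_sub, expect_const_mul, expect_const_mul]
  ring

open Classical in
/-- **The edge cross-term of the pendant Lemma 6 is non-negative** (`proofs/P1-lemma7.md` §11):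
with `p₀ = p[e ↦ 0]`, `p₁ = p[e ↦ 1]`, `x₀ Y₁ + x₁ Y₀ ≤ R₀ T₁ + R₁ T₀`. -/
theorem pendant_B6 (v i j k : V) {p : E → ℝ} (hp : IsProb p) (e : E) :
    prob (Function.update p e 0) (G.pairEvent v i j k ∩ G.connEvent j k) *
        prob (Function.update p e 1) (G.attachEvent v i j k ∩ G.sepEvent j k) +
      prob (Function.update p e 1) (G.pairEvent v i j k ∩ G.connEvent j k) *
        prob (Function.update p e 0) (G.attachEvent v i j k ∩ G.sepEvent j k) ≤
    prob (Function.update p e 0) (G.pairEvent v i j k ∩ G.sepEvent j k) *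
        prob (Function.update p e 1) (G.attachEvent v i j k ∩ G.connEvent j k) +
      prob (Function.update p e 1) (G.pairEvent v i j k ∩ G.sepEvent j k) *
        prob (Function.update p e 0) (G.attachEvent v i j k ∩ G.connEvent j k) := by
  have hp₀ : IsProb (Function.update p e 0) := hp.update e ⟨le_rfl, zero_le_one⟩
  have hp₁ : IsProb (Function.update p e 1) := hp.update e ⟨zero_le_one, le_rfl⟩
  have hle : Function.update p e 0 ≤ Function.update p e 1 := by
    intro e'
    by_cases h : e' = e
    · subst h
      simp
    · simp [Function.update_of_ne h]
  set p₀ := Function.update p e 0 with hp₀def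
  set p₁ := Function.update p e 1 with hp₁def
  -- D-side facts (Harris at both e-states, monotonicity)
  have hT₀ := harris hp₀ (G.isUpperSet_attachEvent v i j k) (G.isUpperSet_connEvent j k)
  have hT₁ := harris hp₁ (G.isUpperSet_attachEvent v i j k) (G.isUpperSet_connEvent j k)
  have hs₀ := prob_inter_add_prob_inter_compl p₀ (G.attachEvent v i j k) (G.connEvent j k)
  have hs₁ := prob_inter_add_prob_inter_compl p₁ (G.attachEvent v i j k) (G.connEvent j k)
  have hd := prob_mono_of_isUpperSet hp₀ hp₁ hle (G.isUpperSet_attachEvent v i j k)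
  have hQ := prob_mono_of_isUpperSet hp₀ hp₁ hle (G.isUpperSet_connEvent j k)
  have hd₀ := prob_nonneg hp₀ (G.attachEvent v i j k)
  have hQ₁ := prob_le_one hp₁ (G.connEvent j k)
  have hT₀' : prob p₀ (G.connEvent j k) * prob p₀ (G.attachEvent v i j k) ≤
      prob p₀ (G.attachEvent v i j k ∩ G.connEvent j k) := by rw [mul_comm]; exact hT₀
  have hT₁' : prob p₁ (G.connEvent j k) * prob p₁ (G.attachEvent v i j k) ≤
      prob p₁ (G.attachEvent v i j k ∩ G.connEvent j k) := by rw [mul_comm]; exact hT₁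
  have hY₀' : prob p₀ (G.attachEvent v i j k ∩ (G.connEvent j k)ᶜ) ≤
      (1 - prob p₀ (G.connEvent j k)) * prob p₀ (G.attachEvent v i j k) := by nlinarith
  have hY₁' : prob p₁ (G.attachEvent v i j k ∩ (G.connEvent j k)ᶜ) ≤
      (1 - prob p₁ (G.connEvent j k)) * prob p₁ (G.attachEvent v i j k) := by nlinarith
  have hTn₀ := prob_nonneg hp₀ (G.attachEvent v i j k ∩ G.connEvent j k)
  have hTn₁ := prob_nonneg hp₁ (G.attachEvent v i j k ∩ G.connEvent j k)
  have hYn₀ := prob_nonneg hp₀ (G.attachEvent v i j k ∩ (G.connEvent j k)ᶜ)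
  have hYn₁ := prob_nonneg hp₁ (G.attachEvent v i j k ∩ (G.connEvent j k)ᶜ)
  -- F-side identities
  have hx₀ := G.prob_pairEvent_inter_connEvent_eq p₀ v i j k
  have hx₁ := G.prob_pairEvent_inter_connEvent_eq p₁ v i j k
  have hR₀ : prob p₀ (G.pairEvent v i j k ∩ G.sepEvent j k) =
      expect p₀ (fun ω => pairFun i j k (G.cluster ω v) * (1 - G.condJ p₀ v j k ω)) :=
    G.prob_pairEvent_inter_compl_eq p₀ v i j k
  have hR₁ : prob p₁ (G.pairEvent v i j k ∩ G.sepEvent j k) =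
      expect p₁ (fun ω => pairFun i j k (G.cluster ω v) * (1 - G.condJ p₁ v j k ω)) :=
    G.prob_pairEvent_inter_compl_eq p₁ v i j k
  have hsep₀ : prob p₀ (G.attachEvent v i j k ∩ G.sepEvent j k) =
      prob p₀ (G.attachEvent v i j k ∩ (G.connEvent j k)ᶜ) := rfl
  have hsep₁ : prob p₁ (G.attachEvent v i j k ∩ G.sepEvent j k) =
      prob p₁ (G.attachEvent v i j k ∩ (G.connEvent j k)ᶜ) := rfl
  rw [hx₀, hx₁, hR₀, hR₁, hsep₀, hsep₁, ← sub_nonneg]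
  have hcomb : expect p₀ (fun ω => pairFun i j k (G.cluster ω v) * (1 - G.condJ p₀ v j k ω)) *
        prob p₁ (G.attachEvent v i j k ∩ G.connEvent j k) +
      expect p₁ (fun ω => pairFun i j k (G.cluster ω v) * (1 - G.condJ p₁ v j k ω)) *
        prob p₀ (G.attachEvent v i j k ∩ G.connEvent j k) -
      (expect p₀ (fun ω => pairFun i j k (G.cluster ω v) * G.condJ p₀ v j k ω) *
          prob p₁ (G.attachEvent v i j k ∩ (G.connEvent j k)ᶜ) +
        expect p₁ (fun ω => pairFun i j k (G.cluster ω v) * G.condJ p₁ v j k ω) *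
          prob p₀ (G.attachEvent v i j k ∩ (G.connEvent j k)ᶜ)) =
      expect p₀ (fun ω => pairFun i j k (G.cluster ω v) *
          ((1 - G.condJ p₀ v j k ω) * prob p₁ (G.attachEvent v i j k ∩ G.connEvent j k) -
            G.condJ p₀ v j k ω * prob p₁ (G.attachEvent v i j k ∩ (G.connEvent j k)ᶜ))) +
        expect p₁ (fun ω => pairFun i j k (G.cluster ω v) *
          ((1 - G.condJ p₁ v j k ω) * prob p₀ (G.attachEvent v i j k ∩ G.connEvent j k) -
            G.condJ p₁ v j k ω * prob p₀ (G.attachEvent v i j k ∩ (G.connEvent j k)ᶜ))) := by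
    rw [← expect_comb, ← expect_comb]
    ring
  rw [hcomb]
  -- split the `p₁` term by whether `e` touches the cluster
  set g : Set V → ℝ := fun W => pairFun i j k W *
      ((1 - prob (zeroOn p₁ (G.touchingFinset W)) (G.connEvent j k)) *
          prob p₀ (G.attachEvent v i j k ∩ G.connEvent j k) -
        prob (zeroOn p₁ (G.touchingFinset W)) (G.connEvent j k) *
          prob p₀ (G.attachEvent v i j k ∩ (G.connEvent j k)ᶜ)) *
      (if e ∈ G.touchingFinset W then 0 else 1) with hgdef
  have hsplit : (fun ω => pairFun i j k (G.cluster ω v) *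
        ((1 - G.condJ p₁ v j k ω) * prob p₀ (G.attachEvent v i j k ∩ G.connEvent j k) -
          G.condJ p₁ v j k ω * prob p₀ (G.attachEvent v i j k ∩ (G.connEvent j k)ᶜ))) =
      (fun ω => g (G.cluster ω v)) + fun ω => pairFun i j k (G.cluster ω v) *
        ((1 - G.condJ p₁ v j k ω) * prob p₀ (G.attachEvent v i j k ∩ G.connEvent j k) -
          G.condJ p₁ v j k ω * prob p₀ (G.attachEvent v i j k ∩ (G.connEvent j k)ᶜ)) *
        (if e ∈ G.touchingFinset (G.cluster ω v) then 1 else 0) := by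
    funext ω
    simp only [Pi.add_apply, hgdef, condJ]
    split_ifs <;> ring
  rw [hsplit, expect_add]
  have hg : ∀ W, e ∈ G.touchingFinset W → g W = 0 := fun W hW => by simp [hgdef, hW]
  rw [G.expect_clusterFun_update_eq p v e 1 0 g hg, ← hp₀def, ← add_assoc, ← expect_add]
  -- pointwise facts
  have hΨ : ∀ ω, 0 ≤ pairFun i j k (G.cluster ω v) := fun ω => pairFun_nonneg i j k _
  have hH₀le : ∀ ω, G.condJ p₀ v j k ω ≤ prob p₀ (G.connEvent j k) :=
    fun ω => G.condJ_le hp₀ v j k ω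
  have hH₁le : ∀ ω, G.condJ p₁ v j k ω ≤ prob p₁ (G.connEvent j k) :=
    fun ω => G.condJ_le hp₁ v j k ω
  have hH₀0 : ∀ ω, 0 ≤ G.condJ p₀ v j k ω := fun ω => G.condJ_nonneg hp₀ v j k ω
  have hH₁0 : ∀ ω, 0 ≤ G.condJ p₁ v j k ω := fun ω => G.condJ_nonneg hp₁ v j k ω
  -- the bracket with the F-copy at e closed is always ≥ 0
  have hbr₀ : ∀ ω, 0 ≤ (1 - G.condJ p₀ v j k ω) *
      prob p₁ (G.attachEvent v i j k ∩ G.connEvent j k) -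
      G.condJ p₀ v j k ω * prob p₁ (G.attachEvent v i j k ∩ (G.connEvent j k)ᶜ) := by
    intro ω
    have h1 : G.condJ p₀ v j k ω ≤ prob p₁ (G.connEvent j k) := (hH₀le ω).trans hQ
    have h2 : G.condJ p₀ v j k ω * prob p₁ (G.attachEvent v i j k ∩ (G.connEvent j k)ᶜ) ≤
        prob p₁ (G.connEvent j k) * prob p₁ (G.attachEvent v i j k ∩ (G.connEvent j k)ᶜ) :=
      mul_le_mul_of_nonneg_right h1 hYn₁
    have h3 : prob p₁ (G.connEvent j k) * prob p₁ (G.attachEvent v i j k ∩ (G.connEvent j k)ᶜ) ≤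
        (1 - prob p₁ (G.connEvent j k)) * prob p₁ (G.attachEvent v i j k ∩ G.connEvent j k) := by
      nlinarith
    have h4 : (1 - prob p₁ (G.connEvent j k)) *
        prob p₁ (G.attachEvent v i j k ∩ G.connEvent j k) ≤
        (1 - G.condJ p₀ v j k ω) * prob p₁ (G.attachEvent v i j k ∩ G.connEvent j k) :=
      mul_le_mul_of_nonneg_right (by linarith) hTn₁
    linarith
  refine add_nonneg (expect_nonneg hp₀ fun ω => ?_) (expect_nonneg hp₁ fun ω => ?_)
  · simp only [Pi.add_apply, hgdef]
    by_cases he : e ∈ G.touchingFinset (G.cluster ω v)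
    · rw [if_pos he, mul_zero, add_zero]
      exact mul_nonneg (hΨ ω) (hbr₀ ω)
    · rw [if_neg he, mul_one]
      have hcross := cross_abstract (hH₀0 ω) (hH₁0 ω) (hH₀le ω) hQ (hH₁le ω) hQ₁ hT₀' hT₁'
        hY₀' hY₁' hd₀ hd
      have hc' : G.condJ p₁ v j k ω =
          prob (zeroOn p₁ (G.touchingFinset (G.cluster ω v))) (G.connEvent j k) := rfl
      rw [← hc', ← mul_add]
      exact mul_nonneg (hΨ ω) (by linarith [hcross])
  · by_cases he : e ∈ G.touchingFinset (G.cluster ω v)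
    · rw [if_pos he]
      have hEq : G.condJ p₁ v j k ω = G.condJ p₀ v j k ω :=
        G.condJ_update_of_mem p v j k ω he 1 0
      have h1 : G.condJ p₁ v j k ω ≤ prob p₀ (G.connEvent j k) := by rw [hEq]; exact hH₀le ω
      have h2 : G.condJ p₁ v j k ω * prob p₀ (G.attachEvent v i j k ∩ (G.connEvent j k)ᶜ) ≤
          prob p₀ (G.connEvent j k) * prob p₀ (G.attachEvent v i j k ∩ (G.connEvent j k)ᶜ) :=
        mul_le_mul_of_nonneg_right h1 hYn₀
      have h3 : prob p₀ (G.connEvent j k) *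
          prob p₀ (G.attachEvent v i j k ∩ (G.connEvent j k)ᶜ) ≤
          (1 - prob p₀ (G.connEvent j k)) * prob p₀ (G.attachEvent v i j k ∩ G.connEvent j k) := by
        nlinarith
      have h4 : (1 - prob p₀ (G.connEvent j k)) *
          prob p₀ (G.attachEvent v i j k ∩ G.connEvent j k) ≤
          (1 - G.condJ p₁ v j k ω) * prob p₀ (G.attachEvent v i j k ∩ G.connEvent j k) :=
        mul_le_mul_of_nonneg_right (by linarith) hTn₀
      have hbr : 0 ≤ (1 - G.condJ p₁ v j k ω) *
          prob p₀ (G.attachEvent v i j k ∩ G.connEvent j k) -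
          G.condJ p₁ v j k ω * prob p₀ (G.attachEvent v i j k ∩ (G.connEvent j k)ᶜ) := by
        linarith
      rw [mul_one]
      exact mul_nonneg (hΨ ω) hbr
    · rw [if_neg he, mul_zero]
end Prob
end MultiGraph
end PercRepro
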